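import Summits.HodgeConjecture.HodgeConjecture.Theorems.GenericDivisibilityHodgeClassesGenericallyDivisibleFinite
import Literature.AlgebraicTopology.SingularHomology.CohomologyBocksteinRepresentatives
import Literature.AlgebraicGeometry.Motives.UnramifiedCohomology

/-!
# Route GenericDivisibility — crux `HodgeClassesGenericallyDivisible` (C1, item stmt-HodgeConjecture-18466):
# "Hodge classes are unramified-invisible" — C1 in the Bloch–Ogus vocabulary of the tree

Companion to `Theorems/GenericDivisibilityHodgeClassesGenericallyDivisible` and `…Finite` (whose
`hodgeClassesGenericallyDivisible_iff_reduceMod` reads C1 with finite coefficients through the tree's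
Bockstein map `reduceMod`).  Here the finite-coefficient reading is transported to the coefficient RING
`ℤ/m` and to the tree's Bloch–Ogus vocabulary `Motives.coniveauFiltration`, `Motives.unramifiedClass`
(`Literature/AlgebraicGeometry/Motives/UnramifiedCohomology`), making the item's informal gloss — "the
mod-`m` reduction of `z` has coniveau `≥ 1`", "Hodge classes are unramified-invisible: the image of
`Hdg²ᵖ(X, ℤ)` in `H²ᵖ_nr(X, ℤ/m)` vanishes" — a formal equivalence.  Sorry-free; nothing is claimed
about C1 itself (open for `p ≥ 2`).

* `genericDivisibility_scalarChange_reduceMod` — glue: reduction modulo `m` (`reduceMod`, ground ring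
  `ℤ`) followed by the change of ground ring `ℤ → ℤ/m` (`scalarChange`) is the change of coefficient
  ring `ringChange (ℤ → ℤ/m)`; hence `ρₘ w = 0 ↔ w ⊗ ℤ/m = 0`.
* `hodgeClassesGenericallyDivisible_iff_ringChange_mem_coniveauFiltration_one` — C1 ⟺ for all data
  and all `m ≥ 1`, `z ⊗ ℤ/m ∈ N¹ H²ᵖ(X(ℂ); ℤ/m) = coniveauFiltration (ZMod m) X (2p) 1`.
* `hodgeClassesGenericallyDivisible_of_forall_unramifiedClass_eq_zero` — vanishing of the unramified
  classes of the `z ⊗ ℤ/m` in `H²ᵖ_nr(X, ℤ/m)` implies C1 (unconditionally: a class with zero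
  unramified class dies near the generic point, `ker_unramifiedClass_le_coniveauFiltration_one`);
* `hodgeClassesGenericallyDivisible_iff_forall_unramifiedClass_eq_zero` — and conversely granted the
  named fact `BlochOgus1974_blochOgusSheaf_injective` (Bloch–Ogus 1974 Thm. 4.2: `𝓗^q` embeds in the
  generic stalk), by `coniveauFiltration_one_eq_ker_unramifiedClass_of_isSmoothProjective`.

References: S. Bloch, A. Ogus, Ann. Sci. ÉNS 7 (1974), (3.8), Thm. 4.2 [BlochOgus1974ENS];
J.-L. Colliot-Thélène, C. Voisin, Duke Math. J. 161 (2012), Déf. 2.1–2.2, Thm. 3.1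
[ColliotTheleneVoisin2012]; A. Hatcher, *Algebraic Topology* (2002), §3.1 p. 198, §3.E p. 303
[HatcherAT2002].
-/

-- `Summit.HodgeConjecture.HodgeConjecture.Theorems` is the mandated namespace (single-problem summit:
-- Problem = Summit), which `linter.dupNamespace` flags on every declaration; the lakefile turns the
-- linter off tree-wide (weak option), restated here so stand-alone elaboration is warning-free too.
set_option linter.dupNamespace false

noncomputable section

namespace Summit.HodgeConjecture.HodgeConjecture.Theorems

open CategoryTheory AlgebraicGeometry
open Literature.AlgebraicGeometry.Motives Literature.AlgebraicGeometry.HodgeTheory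
  Literature.AlgebraicTopology.SingularHomology
open Literature.AlgebraicTopology.SingularHomology.singularCochainComplex
open Summit.HodgeConjecture.HodgeConjecture.Theses.GenericDivisibility

universe u in
/-- **Glue between the tree's two changes of coefficients.** Reduction modulo `m`
(`reduceMod = mapCoeff (ℤ → ℤ/m)`, ground ring `ℤ`) followed by the change of ground ring
`scalarChange ℤ (ℤ/m)` is the change of coefficient RING `ringChange (ℤ → ℤ/m)`: all three act on a
representing cocycle `u` by `σ ↦ (u σ : ℤ/m)` (Hatcher §3.1 p. 198: `Hⁿ(X; G)` and its functoriality in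
`G` only see the abelian group `G`). [cite: HatcherAT2002, §3.1 p. 198] -/
theorem genericDivisibility_scalarChange_reduceMod {U : Type u} [TopologicalSpace U] (m n : ℕ)
    (w : singularCohomology ℤ ℤ U n) :
    singularCohomology.scalarChange ℤ (ZMod m) (ZMod m) U n (reduceMod U m n w) =
      singularCohomology.ringChange (Int.castRingHom (ZMod m)) U n w := by
  induction w using singularCohomology_induction_on with
  | h u =>
    rw [reduceMod_π, singularCohomology.scalarChange_π, singularCohomology.ringChange_π]
    congr 1
    refine cocycles_ext ?_
    rw [iCocycles_cocyclesScalarChange]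
    funext σ
    rw [iCocycles_cocyclesMapCoeff_intCast_apply]
    change _ = coFn (cocyclesRingChange (Int.castRingHom (ZMod m)) n u) σ
    rw [coFn_cocyclesRingChange]
    rfl

universe u in
/-- **`ρₘ w = 0 ↔ w ⊗ ℤ/m = 0`**: vanishing of the reduction modulo `m` (`m ≥ 1`) of an integral class
does not depend on whether `Hⁿ(U; ℤ/m)` is formed over the ground ring `ℤ` or `ℤ/m` (`scalarChange` is
an isomorphism, `scalarChange_eq_zero_iff`). [cite: HatcherAT2002, §3.1 p. 198] -/
theorem genericDivisibility_reduceMod_eq_zero_iff_ringChange_eq_zero {U : Type u} [TopologicalSpace U]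
    (m n : ℕ) [NeZero m] (w : singularCohomology ℤ ℤ U n) :
    reduceMod U m n w = 0 ↔ singularCohomology.ringChange (Int.castRingHom (ZMod m)) U n w = 0 := by
  rw [← genericDivisibility_scalarChange_reduceMod, singularCohomology.scalarChange_eq_zero_iff]

/-- **C1 ⟺ "the mod-`m` reduction of `z` has coniveau `≥ 1`".** `HodgeClassesGenericallyDivisible`
is equivalent to: for `p ≥ 1`, `X` a smooth projective complex `2p`-fold, `z ∈ H²ᵖ(X(ℂ); ℤ)` with
`(p,p)` complexification and every `m ≥ 1`, the class `z ⊗ ℤ/m ∈ H²ᵖ(X(ℂ); ℤ/m)` lies in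
`N¹ H²ᵖ(X(ℂ); ℤ/m) = coniveauFiltration (ZMod m) X (2p) 1` (Bloch–Ogus coniveau filtration with
`ℤ/m`-coefficients, the tree's `Motives.coniveauFiltration`): divisibility by `m` on `U(ℂ)` is
vanishing modulo `m` there (Bockstein, `hodgeClassesGenericallyDivisible_iff_reduceMod`), reduction
modulo `m` commutes with restriction (`singularCohomology.ringChange_map`), and on the irreducible `X`
a closed `Z` has codimension `≥ 1` pointwise iff `Z ≠ X` (`forall_one_le_coheight_iff_ne_univ`).
[cite: BlochOgus1974ENS, (3.8)] [cite: HatcherAT2002, §3.E p. 303] -/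
theorem hodgeClassesGenericallyDivisible_iff_ringChange_mem_coniveauFiltration_one :
    HodgeClassesGenericallyDivisible ↔
      ∀ ⦃p : ℕ⦄ ⦃X : SchemeOver ℂ⦄, 1 ≤ p → IsSmoothProjective (2 * p) X →
        ∀ z : singularCohomology ℤ ℤ (ComplexPoints X) (2 * p),
          IsOfHodgeType (2 * p) X (2 * p) p p
            (singularCohomology.ringChange (Int.castRingHom ℂ) (ComplexPoints X) (2 * p) z) →
          ∀ (m : ℕ) [NeZero m],
            singularCohomology.ringChange (Int.castRingHom (ZMod m)) (ComplexPoints X) (2 * p) z ∈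
              coniveauFiltration (ZMod m) X (2 * p) 1 := by
  rw [hodgeClassesGenericallyDivisible_iff_reduceMod]
  refine forall₅_congr fun p X hp hX z ↦ forall_congr' fun hz ↦ forall_congr' fun m ↦
    forall_congr' fun _ ↦ ?_
  haveI : IrreducibleSpace X.left := by
    haveI := hX.geometricallyIrreducible
    exact AlgebraicGeometry.GeometricallyIrreducible.irreducibleSpace_of_subsingleton X.hom
  rw [mem_coniveauFiltration_iff_exists]
  refine exists_congr fun Z ↦ and_congr_right fun hZ ↦ ?_
  rw [forall_one_le_coheight_iff_ne_univ hZ]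
  refine and_congr_right fun _ ↦ ?_
  rw [genericDivisibility_reduceMod_eq_zero_iff_ringChange_eq_zero,
    singularCohomology.ringChange_map]

/-- **"Hodge classes are unramified-invisible" ⟹ C1 (no Bloch–Ogus input).** If for every `p ≥ 1`,
smooth projective complex `2p`-fold `X`, integral middle class `z` with `(p,p)` complexification and
`m ≥ 1` the UNRAMIFIED CLASS of `z ⊗ ℤ/m` in `H²ᵖ_nr(X, ℤ/m) = H⁰(X_Zar, 𝓗²ᵖ(ℤ/m))`
(`Motives.unramifiedClass`) vanishes, then `HodgeClassesGenericallyDivisible`: a class with zero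
unramified class dies on a Zariski neighbourhood of the generic point
(`ker_unramifiedClass_le_coniveauFiltration_one`, unconditional on an irreducible `X`), i.e. has
coniveau `≥ 1`. [cite: ColliotTheleneVoisin2012, Déf. 2.2 and Thm 3.1] [cite: BlochOgus1974ENS, (3.8)] -/
theorem hodgeClassesGenericallyDivisible_of_forall_unramifiedClass_eq_zero
    (h : ∀ ⦃p : ℕ⦄ ⦃X : SchemeOver ℂ⦄, 1 ≤ p → IsSmoothProjective (2 * p) X →
      ∀ z : singularCohomology ℤ ℤ (ComplexPoints X) (2 * p),
        IsOfHodgeType (2 * p) X (2 * p) p p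
          (singularCohomology.ringChange (Int.castRingHom ℂ) (ComplexPoints X) (2 * p) z) →
        ∀ (m : ℕ) [NeZero m],
          unramifiedClass (ZMod m) X (2 * p)
            (singularCohomology.ringChange (Int.castRingHom (ZMod m)) (ComplexPoints X) (2 * p) z)
              = 0) :
    HodgeClassesGenericallyDivisible := by
  rw [hodgeClassesGenericallyDivisible_iff_ringChange_mem_coniveauFiltration_one]
  intro p X hp hX z hz m _
  haveI : IrreducibleSpace X.left := by
    haveI := hX.geometricallyIrreducible
    exact AlgebraicGeometry.GeometricallyIrreducible.irreducibleSpace_of_subsingleton X.hom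
  exact ker_unramifiedClass_le_coniveauFiltration_one (ZMod m) X (2 * p)
    (LinearMap.mem_ker.2 (h hp hX z hz m))

/-- **C1 ⟺ "Hodge classes are unramified-invisible", granted Bloch–Ogus injectivity.** Granted the
named fact `BlochOgus1974_blochOgusSheaf_injective` (Bloch–Ogus 1974, Thm. 4.2: the Zariski sheaf
`𝓗^q` embeds into the constant sheaf of the generic stalk), `N¹ H²ᵖ(X(ℂ); ℤ/m)` is exactly the kernel of
the unramified-class map (`coniveauFiltration_one_eq_ker_unramifiedClass_of_isSmoothProjective`), so
`HodgeClassesGenericallyDivisible` says: the unramified class in `H²ᵖ_nr(X, ℤ/m)` of the reduction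
modulo every `m` of every integral middle Hodge class vanishes — the route's slogan, in the tree's
Bloch–Ogus vocabulary. [cite: BlochOgus1974ENS, (3.8) and Thm. 4.2] [cite: ColliotTheleneVoisin2012, Déf. 2.2] -/
theorem hodgeClassesGenericallyDivisible_iff_forall_unramifiedClass_eq_zero
    (hBO : BlochOgus1974_blochOgusSheaf_injective) :
    HodgeClassesGenericallyDivisible ↔
      ∀ ⦃p : ℕ⦄ ⦃X : SchemeOver ℂ⦄, 1 ≤ p → IsSmoothProjective (2 * p) X →
        ∀ z : singularCohomology ℤ ℤ (ComplexPoints X) (2 * p),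
          IsOfHodgeType (2 * p) X (2 * p) p p
            (singularCohomology.ringChange (Int.castRingHom ℂ) (ComplexPoints X) (2 * p) z) →
          ∀ (m : ℕ) [NeZero m],
            unramifiedClass (ZMod m) X (2 * p)
              (singularCohomology.ringChange (Int.castRingHom (ZMod m)) (ComplexPoints X) (2 * p) z)
                = 0 := by
  rw [hodgeClassesGenericallyDivisible_iff_ringChange_mem_coniveauFiltration_one]
  refine forall₅_congr fun p X hp hX z ↦ forall_congr' fun hz ↦ forall_congr' fun m ↦
    forall_congr' fun _ ↦ ?_
  rw [coniveauFiltration_one_eq_ker_unramifiedClass_of_isSmoothProjective (ZMod m) (2 * p) hBO hX,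
    LinearMap.mem_ker]

end Summit.HodgeConjecture.HodgeConjecture.Theorems

end
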